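import Literature.Probability.RandomPlanarGeometry.SAWPulledLargeForceExpansionZdDegreeProfile
import Literature.Probability.RandomPlanarGeometry.SAWPulledLargeForceExpansionZdTopSymbol
import HarnessLib

/-!
# Pulled SAW on `ℤ^{d+1}`: RIGIDITY of the top axis class of the span-two cell `(c, c+2)`

Topic `Literature/Probability/RandomPlanarGeometry` (continues `SAWPulledLargeForceExpansionZdDegreeProfile.lean`: `height_add_axes_add_two_mul_down_le`,
`span_sub_one_le_card_down`; the axis classes of `SAWPulledLargeForceExpansionZdCostPolynomial.lean`).

By the degree profile, `deg_d N_{c,c+2}(ℤ^{d+1}) ≤ c − 2`, carried by the axis class `F_{c,c+2}(c−2)` = the cost-`c`, length-`c+2` irreducible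
bridges of `ℤ^{c−1}` using all `c − 2` lateral axes. THIS FILE proves the RIGIDITY of that class (lane «pcv-sawmu», a-p1 g18; all PROVED,
standard axioms, NO definitions): with `u = c − 2`, a member `ω ∈ irreducibleBridges (u+1) (u+4)` of cost `u + 2` using every lateral axis
* ends at height `2` (`apply_zero_eq_two_of_spanTwoTopClass`),
* makes EXACTLY ONE down step (`card_down_eq_one_of_spanTwoTopClass`), exactly three up steps and exactly `u` lateral steps
  (`card_up_eq_three_of_spanTwoTopClass`, `card_lateral_eq_of_spanTwoTopClass`),
* and its lateral steps are on PAIRWISE DISTINCT axes (`lateral_axes_injOn_of_spanTwoTopClass`);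
and the LOWER-BOUND half of the count `F_{c,c+2}(c−2) = C(c−1,3)·(c−2)!·2^{c−2}` (lane FINDING-ZD-SYMBOLS.md §2): the INSERTION of
three non-adjacent vertical steps `U, D, U` at indices `1 ≤ p`, `p+2 ≤ q`, `q+2 ≤ r ≤ u+3` into a member `ω'` of the top class of the
span-ONE cell (`SAWPulledLargeForceExpansionZdTopSymbol.card_topAxesClass_self`: `2^u·u!` members) — `t ↦ ω'(t − m(t)) + g(t)·e₀`,
`m = [p<t]+[q<t]+[r<t]`, `g = [p<t]−[q<t]+[r<t]` — lands in the class (`insert_mem_spanTwoTopClass`) injectively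
(`insert_injective_spanTwoTopClass`), the admissible triples number `C(u+1,3)` (`card_admissibleTriples`), hence
★★ `choose_mul_le_card_spanTwoTopClass : 2^u·u!·C(u+1,3) ≤ F_{u+2,u+4}(u)`. (The matching upper bound — every member is an
insertion, by the rigidity — is the sequel.)
[cite: MadrasSlade1993, §4.2, eq. (4.2.20)–(4.2.22) and remark after Theorem 4.2.4 (cost = length − span; down steps of irreducible bridges)]
[cite: DuminilCopinHammond2013, §2.2 (irreducible bridges)]

Provenance: lane «pcv-sawmu», a-p1 g18 (2026-08-26).
-/

noncomputable section

open Finset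
open scoped BigOperators
open Literature.Probability.LatticeModels
open Literature.Probability.RandomPlanarGeometry.SAW

namespace Literature.Probability.RandomPlanarGeometry.SAW.Zd

section SpanTwoTop

variable {u : ℕ}

/-- The steps of a self-avoiding walk are unit coordinate vectors `± e_j`. [cite: MadrasSlade1993, §1.1 (p. 1); lane plumbing] -/
private theorem st_exists_step_single {D n : ℕ} {ω : ℕ → Site D} (hω : ω ∈ saws D n) {k : ℕ} (hk : k < n) :
    ∃ j : Fin D, ∃ s : ℤ, (s = 1 ∨ s = -1) ∧ ω (k + 1) - ω k = Pi.single j s := by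
  obtain ⟨j, hj | hj⟩ := (zdGraph_adj_iff_sub _ _).1 ((mem_saws.1 hω).2.2.1 k hk)
  · exact ⟨j, 1, Or.inl rfl, hj⟩
  · refine ⟨j, -1, Or.inr rfl, ?_⟩
    rw [Pi.single_neg, ← hj, neg_sub]

/-- A step that moves the height moves it by exactly `±1` and fixes every lateral coordinate; a step that fixes the height moves
exactly one lateral coordinate. [cite: MadrasSlade1993, §1.1 (p. 1); lane plumbing] -/
private theorem st_step_dichotomy {D n : ℕ} {ω : ℕ → Site D} (hω : ω ∈ saws D n) {k : ℕ} (hk : k < n) :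
    ∃ j : Fin D, (ω (k + 1) j - ω k j = 1 ∨ ω (k + 1) j - ω k j = -1) ∧ ∀ b, b ≠ j → ω (k + 1) b = ω k b := by
  obtain ⟨j, s, hs, hjs⟩ := st_exists_step_single hω hk
  refine ⟨j, ?_, fun b hb => ?_⟩
  · have h := congrFun hjs j
    rw [Pi.sub_apply, Pi.single_eq_same] at h
    rcases hs with rfl | rfl
    · exact Or.inl h
    · exact Or.inr h
  · have h := congrFun hjs b
    rw [Pi.sub_apply, Pi.single_eq_of_ne hb] at h
    exact sub_eq_zero.1 h

/-- A coordinate that is nonzero at some time was changed by an earlier step. [cite: MadrasSlade1993, §1.1 (p. 1); lane plumbing] -/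
private theorem st_exists_step_ne {D : ℕ} {ω : ℕ → Site D} (h0 : ω 0 = 0) {a : Fin D} {i : ℕ} (hi : ω i a ≠ 0) :
    ∃ k < i, ω (k + 1) a ≠ ω k a := by
  induction i with
  | zero => exact absurd (by rw [h0]; rfl) hi
  | succ i ih =>
    by_cases h : ω (i + 1) a = ω i a
    · obtain ⟨k, hk, hne⟩ := ih (by rwa [h] at hi)
      exact ⟨k, by omega, hne⟩
    · exact ⟨i, by omega, h⟩

/-- ★ In the top axis class of the span-two cell the final height is `2` (cost `u + 2` at length `u + 4`).
[cite: MadrasSlade1993, §4.2, eq. (4.2.20)–(4.2.22); lane lemma] -/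
theorem apply_zero_eq_two_of_spanTwoTopClass {ω : ℕ → Site (u + 1)} (hω : ω ∈ irreducibleBridges (u + 1) (u + 4))
    (hcost : costZd u (u + 4) ω = u + 2) : ω (u + 4) 0 = 2 := by
  obtain ⟨hb, hn1, hbr, -⟩ := mem_irreducibleBridges.1 hω
  have hpos : 0 < ω (u + 4) 0 := by
    have := (hbr (u + 4) hn1 le_rfl).1
    rwa [(mem_saws.1 (mem_bridges.1 hb).1).1] at this
  unfold costZd at hcost
  have h2 : (ω (u + 4) 0).toNat ≤ u + 4 := by
    have := (span_le_and_cost_bound_zd hω).2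
    omega
  have : ((ω (u + 4) 0).toNat : ℤ) = ω (u + 4) 0 := Int.toNat_of_nonneg hpos.le
  omega

/-- ★★ RIGIDITY, DOWN STEPS: a member of the top axis class of the span-two cell makes EXACTLY ONE down step
(`≥ 1` by irreducibility at span `2`, `≤ 1` by height accounting with all `u` lateral axes used).
[cite: MadrasSlade1993, §4.2, remark after Theorem 4.2.4; lane lemma] -/
theorem card_down_eq_one_of_spanTwoTopClass {ω : ℕ → Site (u + 1)} (hω : ω ∈ irreducibleBridges (u + 1) (u + 4))
    (hcost : costZd u (u + 4) ω = u + 2) (hall : ∀ a : Fin (u + 1), a ≠ 0 → ∃ i ≤ u + 4, ω i a ≠ (0 : ℤ)) :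
    ((Finset.range (u + 4)).filter fun k => ω (k + 1) 0 < ω k 0).card = 1 := by
  have h2 := apply_zero_eq_two_of_spanTwoTopClass hω hcost
  have hsaw : ω ∈ saws (u + 1) (u + 4) := (mem_bridges.1 (mem_irreducibleBridges.1 hω).1).1
  have hle := height_add_axes_add_two_mul_down_le hsaw hall
  have hge := span_sub_one_le_card_down hω
  rw [h2] at hle hge
  push_cast at hle
  omega

/-- The height telescopes: final height = #up steps − #down steps. [cite: MadrasSlade1993, §1.1; lane plumbing] -/
private theorem st_height_eq_card_up_sub_card_down {n : ℕ} {ω : ℕ → Site (u + 1)} (hω : ω ∈ saws (u + 1) n) :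
    ω n 0 = (((Finset.range n).filter fun k => ω k 0 < ω (k + 1) 0).card : ℤ) -
      (((Finset.range n).filter fun k => ω (k + 1) 0 < ω k 0).card : ℤ) := by
  classical
  have h0 : ω 0 = 0 := (mem_saws.1 hω).1
  have htel : ω n 0 = ∑ k ∈ Finset.range n, (ω (k + 1) 0 - ω k 0) := by
    rw [Finset.sum_range_sub (fun k => ω k 0) n, h0]; simp
  have hstep : ∀ k ∈ Finset.range n, ω (k + 1) 0 - ω k 0 = (if ω k 0 < ω (k + 1) 0 then 1 else 0) - (if ω (k + 1) 0 < ω k 0 then 1 else 0) := by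
    intro k hk
    obtain ⟨j, hj, hother⟩ := st_step_dichotomy hω (Finset.mem_range.1 hk)
    by_cases hj0 : (0 : Fin (u + 1)) = j
    · subst hj0
      rcases hj with h | h
      · rw [if_pos (by omega), if_neg (by omega)]; omega
      · rw [if_neg (by omega), if_pos (by omega)]; omega
    · have := hother 0 hj0
      rw [if_neg (by omega), if_neg (by omega)]; omega
  rw [htel, Finset.sum_congr rfl hstep, Finset.sum_sub_distrib, Finset.sum_boole, Finset.sum_boole]

/-- The three step kinds partition the steps. [cite: MadrasSlade1993, §1.1; lane plumbing] -/
private theorem st_card_kinds {n : ℕ} {ω : ℕ → Site (u + 1)} :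
    ((Finset.range n).filter fun k => ω k 0 < ω (k + 1) 0).card + ((Finset.range n).filter fun k => ω (k + 1) 0 < ω k 0).card +
      ((Finset.range n).filter fun k => ω (k + 1) 0 = ω k 0).card = n := by
  classical
  have h1 := Finset.card_filter_add_card_filter_not (s := Finset.range n) (fun k => ω (k + 1) 0 = ω k 0)
  have h2 := Finset.card_filter_add_card_filter_not (s := (Finset.range n).filter fun k => ¬ ω (k + 1) 0 = ω k 0)
    (fun k => ω k 0 < ω (k + 1) 0)
  rw [Finset.filter_filter, Finset.filter_filter, Finset.card_range] at *
  have e1 : ((Finset.range n).filter fun k => ¬ ω (k + 1) 0 = ω k 0 ∧ ω k 0 < ω (k + 1) 0) =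
      (Finset.range n).filter fun k => ω k 0 < ω (k + 1) 0 := by
    refine Finset.filter_congr fun k _ => ⟨fun h => h.2, fun h => ⟨by omega, h⟩⟩
  have e2 : ((Finset.range n).filter fun k => ¬ ω (k + 1) 0 = ω k 0 ∧ ¬ ω k 0 < ω (k + 1) 0) =
      (Finset.range n).filter fun k => ω (k + 1) 0 < ω k 0 := by
    refine Finset.filter_congr fun k _ => ⟨fun h => by omega, fun h => ⟨by omega, by omega⟩⟩
  rw [e1, e2] at h2
  omega

/-- ★★ RIGIDITY, UP AND LATERAL STEPS: exactly three up steps and exactly `u` lateral steps.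
[cite: MadrasSlade1993, §4.2, eq. (4.2.20)–(4.2.22); lane lemma] -/
theorem card_up_eq_three_of_spanTwoTopClass {ω : ℕ → Site (u + 1)} (hω : ω ∈ irreducibleBridges (u + 1) (u + 4))
    (hcost : costZd u (u + 4) ω = u + 2) (hall : ∀ a : Fin (u + 1), a ≠ 0 → ∃ i ≤ u + 4, ω i a ≠ (0 : ℤ)) :
    ((Finset.range (u + 4)).filter fun k => ω k 0 < ω (k + 1) 0).card = 3 ∧
    ((Finset.range (u + 4)).filter fun k => ω (k + 1) 0 = ω k 0).card = u := by
  have hsaw : ω ∈ saws (u + 1) (u + 4) := (mem_bridges.1 (mem_irreducibleBridges.1 hω).1).1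
  have h2 := apply_zero_eq_two_of_spanTwoTopClass hω hcost
  have hd := card_down_eq_one_of_spanTwoTopClass hω hcost hall
  have hh := st_height_eq_card_up_sub_card_down hsaw (n := u + 4)
  have hk := st_card_kinds (ω := ω) (n := u + 4)
  rw [h2, hd] at hh
  push_cast at hh
  constructor <;> omega

/-- Shorthand for the card bookkeeping above. [cite: MadrasSlade1993, §4.2; lane plumbing] -/
theorem card_lateral_eq_of_spanTwoTopClass {ω : ℕ → Site (u + 1)} (hω : ω ∈ irreducibleBridges (u + 1) (u + 4))
    (hcost : costZd u (u + 4) ω = u + 2) (hall : ∀ a : Fin (u + 1), a ≠ 0 → ∃ i ≤ u + 4, ω i a ≠ (0 : ℤ)) :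
    ((Finset.range (u + 4)).filter fun k => ω (k + 1) 0 = ω k 0).card = u :=
  (card_up_eq_three_of_spanTwoTopClass hω hcost hall).2

/-- ★★ RIGIDITY, FRESH LATERAL AXES: two lateral steps that move the same lateral coordinate are the same step — the `u` lateral
steps are on pairwise distinct axes (each used lateral axis owns a lateral step, injectively, and there are only `u` lateral steps).
[cite: MadrasSlade1993, §4.2; lane lemma] -/
theorem lateral_axes_injOn_of_spanTwoTopClass {ω : ℕ → Site (u + 1)} (hω : ω ∈ irreducibleBridges (u + 1) (u + 4))
    (hcost : costZd u (u + 4) ω = u + 2) (hall : ∀ a : Fin (u + 1), a ≠ 0 → ∃ i ≤ u + 4, ω i a ≠ (0 : ℤ))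
    {k l : ℕ} (hk : k < u + 4) (hl : l < u + 4) {a : Fin (u + 1)} (ha : a ≠ 0)
    (hka : ω (k + 1) a ≠ ω k a) (hla : ω (l + 1) a ≠ ω l a) : k = l := by
  classical
  have hsaw : ω ∈ saws (u + 1) (u + 4) := (mem_bridges.1 (mem_irreducibleBridges.1 hω).1).1
  have h0 : ω 0 = 0 := (mem_saws.1 hsaw).1
  set Z := (Finset.range (u + 4)).filter (fun k => ω (k + 1) 0 = ω k 0) with hZ
  have hZcard : Z.card = u := card_lateral_eq_of_spanTwoTopClass hω hcost hall
  -- the axis of a step, and the lateral-step ⇒ nonzero axis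
  have hax : ∀ m, m < u + 4 → ∃ j : Fin (u + 1), (ω (m + 1) j - ω m j = 1 ∨ ω (m + 1) j - ω m j = -1) ∧
      ∀ b, b ≠ j → ω (m + 1) b = ω m b := fun m hm => st_step_dichotomy hsaw hm
  -- every lateral axis owns a step in Z changing it; choose one
  have hown : ∀ b : Fin (u + 1), b ≠ 0 → ∃ m ∈ Z, ω (m + 1) b ≠ ω m b := by
    intro b hb
    obtain ⟨i, hi, hne⟩ := hall b hb
    obtain ⟨m, hm, hstep⟩ := st_exists_step_ne h0 hne
    have hmn : m < u + 4 := by omega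
    refine ⟨m, ?_, hstep⟩
    rw [hZ, Finset.mem_filter, Finset.mem_range]
    refine ⟨hmn, ?_⟩
    obtain ⟨j, -, hother⟩ := hax m hmn
    have hjb : j = b := by by_contra h; exact hstep (hother b (fun h' => h h'.symm))
    subst hjb
    exact hother 0 (fun h => hb h.symm)
  -- the map b ↦ chosen step is injective (a step changes one coordinate), so its image has u elements = Z: it is onto Z
  choose f hf using hown
  have hstep_axis : ∀ m, m < u + 4 → ∀ b b' : Fin (u + 1), ω (m + 1) b ≠ ω m b → ω (m + 1) b' ≠ ω m b' → b = b' := by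
    intro m hm b b' hb hb'
    obtain ⟨j, -, hother⟩ := hax m hm
    have h1 : b = j := by by_contra h; exact hb (hother b h)
    have h2 : b' = j := by by_contra h; exact hb' (hother b' h)
    rw [h1, h2]
  have himg : ((Finset.univ : Finset (Fin (u + 1))).filter (fun b => b ≠ 0)).image
      (fun b => if hb : b ≠ 0 then f b hb else 0) = Z := by
    apply Finset.eq_of_subset_of_card_le
    · intro m hm
      obtain ⟨b, hb, rfl⟩ := Finset.mem_image.1 hm
      have hb0 : b ≠ 0 := (Finset.mem_filter.1 hb).2
      simp only [dif_pos hb0]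
      exact (hf b hb0).1
    · rw [hZcard, Finset.card_image_of_injOn]
      · rw [Finset.filter_ne' Finset.univ (0 : Fin (u + 1)), Finset.card_erase_of_mem (Finset.mem_univ _), Finset.card_univ,
          Fintype.card_fin, Nat.add_sub_cancel]
      · intro b hb b' hb' h
        have hb0 : b ≠ 0 := (Finset.mem_filter.1 (Finset.mem_coe.1 hb)).2
        have hb0' : b' ≠ 0 := (Finset.mem_filter.1 (Finset.mem_coe.1 hb')).2
        simp only [dif_pos hb0, dif_pos hb0'] at h
        have h1 := (hf b hb0).2
        have h2 := (hf b' hb0').2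
        rw [h] at h1
        have hm : f b' hb0' < u + 4 := by
          have := (hf b' hb0').1
          rw [hZ, Finset.mem_filter, Finset.mem_range] at this
          exact this.1
        exact hstep_axis _ hm b b' h1 h2
  -- k and l are lateral steps (they change `a ≠ 0`, hence not the height)
  have hkZ : k ∈ Z := by
    rw [hZ, Finset.mem_filter, Finset.mem_range]
    obtain ⟨j, -, hother⟩ := hax k hk
    have hja : j = a := by by_contra h; exact hka (hother a (fun h' => h h'.symm))
    subst hja
    exact ⟨hk, hother 0 (fun h => ha h.symm)⟩
  have hlZ : l ∈ Z := by
    rw [hZ, Finset.mem_filter, Finset.mem_range]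
    obtain ⟨j, -, hother⟩ := hax l hl
    have hja : j = a := by by_contra h; exact hla (hother a (fun h' => h h'.symm))
    subst hja
    exact ⟨hl, hother 0 (fun h => ha h.symm)⟩
  -- both are the chosen step of axis `a`... via the bijection: k = f b for some b, and that b must be a; same for l
  rw [← himg] at hkZ hlZ
  obtain ⟨b, hb, hbk⟩ := Finset.mem_image.1 hkZ
  obtain ⟨b', hb', hbl⟩ := Finset.mem_image.1 hlZ
  have hb0 : b ≠ 0 := (Finset.mem_filter.1 hb).2
  have hb0' : b' ≠ 0 := (Finset.mem_filter.1 hb').2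
  simp only [dif_pos hb0] at hbk
  simp only [dif_pos hb0'] at hbl
  -- step k changes b (as f b) and a, so b = a; likewise b' = a
  have hkb : ω (k + 1) b ≠ ω k b := by rw [← hbk]; exact (hf b hb0).2
  have hlb : ω (l + 1) b' ≠ ω l b' := by rw [← hbl]; exact (hf b' hb0').2
  have e1 : b = a := hstep_axis k hk b a hkb hka
  have e2 : b' = a := hstep_axis l hl b' a hlb hla
  subst e1; subst e2
  rw [← hbk, ← hbl]

end SpanTwoTop


/-! ### The insertion map: a span-one all-fresh bridge plus three non-adjacent vertical steps `U, D, U`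

Given `ω'` in the top axis class of the span-ONE cell of `ℤ^{u+1}` (length `u + 1`: `+e₀` then `u` fresh lateral steps) and step indices
`1 ≤ p`, `p + 2 ≤ q`, `q + 2 ≤ r ≤ u + 3`, the INSERTED walk is `t ↦ ω'(t − m(t)) + g(t)·e₀` with `m(t) = [p<t] + [q<t] + [r<t]` and
`g(t) = [p<t] − [q<t] + [r<t]`: its steps are those of `ω'` with an up step inserted at index `p`, a down step at `q` and an up step at `r`.
The lemmas take a walk `ω` with the hypothesis `hω : ∀ t, ω t = …` (no definition is introduced). -/

section Insert

variable {u : ℕ}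

/-- Bookkeeping of the index shift `m` and the extra height `g` along one step. [cite: MadrasSlade1993, §4.2; lane plumbing] -/
private theorem st_shift_succ {p q r : ℕ} (hp : 1 ≤ p) (hpq : p + 2 ≤ q) (hqr : q + 2 ≤ r) (k : ℕ) :
    ((if p < k + 1 then 1 else 0) + (if q < k + 1 then 1 else 0) + (if r < k + 1 then 1 else 0) : ℕ) =
      ((if p < k then 1 else 0) + (if q < k then 1 else 0) + (if r < k then 1 else 0) : ℕ) +
        (if k = p ∨ k = q ∨ k = r then 1 else 0) ∧
    ((if p < k + 1 then 1 else 0) - (if q < k + 1 then 1 else 0) + (if r < k + 1 then 1 else 0) : ℤ) =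
      ((if p < k then 1 else 0) - (if q < k then 1 else 0) + (if r < k then 1 else 0) : ℤ) +
        (if k = p then 1 else 0) - (if k = q then 1 else 0) + (if k = r then 1 else 0) := by
  constructor
  · by_cases h1 : k = p
    · subst h1; simp only [lt_add_iff_pos_right, Nat.lt_irrefl, if_false, if_true, true_or]
      split_ifs <;> omega
    · by_cases h2 : k = q
      · subst h2; split_ifs <;> omega
      · by_cases h3 : k = r
        · subst h3; split_ifs <;> omega
        · split_ifs <;> omega
  · split_ifs <;> omega

/-- The shifted index `t − m(t)` stays in `[1, u+1]` for `t ∈ [1, u+4]`, and `m ≤ 3`, `g ∈ {0, 1}`, with `g = 1` at the end.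
[cite: MadrasSlade1993, §4.2; lane plumbing] -/
private theorem st_shift_bounds {p q r : ℕ} (hp : 1 ≤ p) (hpq : p + 2 ≤ q) (hqr : q + 2 ≤ r) (hr : r ≤ u + 3) (t : ℕ) :
    ((if p < t then 1 else 0) + (if q < t then 1 else 0) + (if r < t then 1 else 0) : ℕ) ≤ 3 ∧
    (1 ≤ t → 1 ≤ t - ((if p < t then 1 else 0) + (if q < t then 1 else 0) + (if r < t then 1 else 0) : ℕ)) ∧
    (t ≤ u + 4 → t - ((if p < t then 1 else 0) + (if q < t then 1 else 0) + (if r < t then 1 else 0) : ℕ) ≤ u + 1) ∧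
    (0 ≤ ((if p < t then 1 else 0) - (if q < t then 1 else 0) + (if r < t then 1 else 0) : ℤ)) ∧
    (((if p < t then 1 else 0) - (if q < t then 1 else 0) + (if r < t then 1 else 0) : ℤ) ≤ 1) ∧
    (u + 4 ≤ t → ((if p < t then 1 else 0) + (if q < t then 1 else 0) + (if r < t then 1 else 0) : ℕ) = 3 ∧
      ((if p < t then 1 else 0) - (if q < t then 1 else 0) + (if r < t then 1 else 0) : ℤ) = 1) := by
  refine ⟨by split_ifs <;> omega, fun ht => by split_ifs <;> omega, fun ht => by split_ifs <;> omega,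
    by split_ifs <;> omega, by split_ifs <;> omega, fun ht => ⟨by split_ifs <;> omega, by split_ifs <;> omega⟩⟩

/-- ★ HEIGHTS of the inserted walk: `ω(t)₀ = 1 + g(t)` for `t ≥ 1` (heights `1` on `[1,p] ∪ (q,r]`, `2` on `(p,q] ∪ (r, ∞)`).
[cite: MadrasSlade1993, §4.2 (bridges); lane lemma] -/
private theorem st_insert_apply_zero {ω ω' : ℕ → Site (u + 1)} {p q r : ℕ}
    (hω' : ω' ∈ (irreducibleBridges (u + 1) (u + 1)).filter fun (ω : ℕ → Site (u + 1)) => costZd u (u + 1) ω = u ∧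
        ∀ a : Fin (u + 1), a ≠ 0 → ∃ i ≤ u + 1, ω i a ≠ (0 : ℤ))
    (hp : 1 ≤ p) (hpq : p + 2 ≤ q) (hqr : q + 2 ≤ r) (hr : r ≤ u + 3)
    (hω : ∀ t : ℕ, ω t = ω' (t - ((if p < t then 1 else 0) + (if q < t then 1 else 0) + (if r < t then 1 else 0))) +
      Pi.single (0 : Fin (u + 1)) (((if p < t then 1 else 0) - (if q < t then 1 else 0) + (if r < t then 1 else 0) : ℤ)))
    {t : ℕ} (ht : 1 ≤ t) :
    ω t 0 = 1 + ((if p < t then 1 else 0) - (if q < t then 1 else 0) + (if r < t then 1 else 0) : ℤ) := by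
  obtain ⟨hI, hcost, hall⟩ := Finset.mem_filter.1 hω'
  have hsaw : ω' ∈ saws (u + 1) (u + 1) := (mem_bridges.1 (mem_irreducibleBridges.1 hI).1).1
  obtain ⟨-, hend, -, -⟩ := mem_saws.1 hsaw
  obtain ⟨-, h1, hle, -⟩ := st_shift_bounds (u := u) hp hpq hqr hr t
  have hone : ∀ s, 1 ≤ s → ω' s 0 = 1 := by
    intro s hs
    by_cases hsn : s ≤ u + 1
    · exact apply_zero_eq_one_of_topAxesClass hI hcost hall hs hsn
    · rw [hend s (by omega)]
      exact apply_zero_eq_one_of_topAxesClass hI hcost hall (by omega) le_rfl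
  rw [hω t, Pi.add_apply, Pi.single_eq_same, hone _ (h1 ht)]

/-- ★★ THE INSERTED WALK LIES IN THE TOP AXIS CLASS OF THE SPAN-TWO CELL: it is an irreducible bridge of `ℤ^{u+1}` of length `u + 4`,
cost `u + 2`, using every lateral axis. [cite: MadrasSlade1993, §4.2, eq. (4.2.20)–(4.2.22) and remark after Theorem 4.2.4; lane lemma] -/
theorem insert_mem_spanTwoTopClass {ω ω' : ℕ → Site (u + 1)} {p q r : ℕ}
    (hω' : ω' ∈ (irreducibleBridges (u + 1) (u + 1)).filter fun (ω : ℕ → Site (u + 1)) => costZd u (u + 1) ω = u ∧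
        ∀ a : Fin (u + 1), a ≠ 0 → ∃ i ≤ u + 1, ω i a ≠ (0 : ℤ))
    (hp : 1 ≤ p) (hpq : p + 2 ≤ q) (hqr : q + 2 ≤ r) (hr : r ≤ u + 3)
    (hω : ∀ t : ℕ, ω t = ω' (t - ((if p < t then 1 else 0) + (if q < t then 1 else 0) + (if r < t then 1 else 0))) +
      Pi.single (0 : Fin (u + 1)) (((if p < t then 1 else 0) - (if q < t then 1 else 0) + (if r < t then 1 else 0) : ℤ))) :
    ω ∈ (irreducibleBridges (u + 1) (u + 4)).filter fun (ω : ℕ → Site (u + 1)) => costZd u (u + 4) ω = u + 2 ∧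
        ∀ a : Fin (u + 1), a ≠ 0 → ∃ i ≤ u + 4, ω i a ≠ (0 : ℤ) := by
  classical
  obtain ⟨hI, hcost, hall⟩ := Finset.mem_filter.1 hω'
  have hsaw : ω' ∈ saws (u + 1) (u + 1) := (mem_bridges.1 (mem_irreducibleBridges.1 hI).1).1
  obtain ⟨h0', hend', hadj', hinj'⟩ := mem_saws.1 hsaw
  -- abbreviations for the shift and the extra height (as functions)
  set m : ℕ → ℕ := fun t => (if p < t then 1 else 0) + (if q < t then 1 else 0) + (if r < t then 1 else 0) with hm
  set g : ℕ → ℤ := fun t => (if p < t then 1 else 0) - (if q < t then 1 else 0) + (if r < t then 1 else 0) with hg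
  have hωt : ∀ t, ω t = ω' (t - m t) + Pi.single (0 : Fin (u + 1)) (g t) := fun t => by rw [hω t]
  have hheight : ∀ t, 1 ≤ t → ω t 0 = 1 + g t := fun t ht => by
    have := st_insert_apply_zero hω' hp hpq hqr hr hω ht
    rw [this]
  have hg01 : ∀ t, 0 ≤ g t ∧ g t ≤ 1 := fun t => by
    obtain ⟨-, -, -, h1, h2, -⟩ := st_shift_bounds (u := u) hp hpq hqr hr t
    exact ⟨h1, h2⟩
  have hρle : ∀ t, t ≤ u + 4 → t - m t ≤ u + 1 := fun t ht => (st_shift_bounds (u := u) hp hpq hqr hr t).2.2.1 ht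
  have hρ1 : ∀ t, 1 ≤ t → 1 ≤ t - m t := fun t ht => (st_shift_bounds (u := u) hp hpq hqr hr t).2.1 ht
  have hm3 : ∀ t, m t ≤ 3 := fun t => (st_shift_bounds (u := u) hp hpq hqr hr t).1
  have hend3 : ∀ t, u + 4 ≤ t → m t = 3 ∧ g t = 1 := fun t ht => (st_shift_bounds (u := u) hp hpq hqr hr t).2.2.2.2.2 ht
  -- the shift along one step
  have hstep_shift : ∀ k, m (k + 1) = m k + (if k = p ∨ k = q ∨ k = r then 1 else 0) ∧
      g (k + 1) = g k + (if k = p then 1 else 0) - (if k = q then 1 else 0) + (if k = r then 1 else 0) := fun k =>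
    st_shift_succ hp hpq hqr k
  -- (1) lateral coordinates: `ω t a = ω' (t − m t) a` for `a ≠ 0`
  have hlat : ∀ t, ∀ a : Fin (u + 1), a ≠ 0 → ω t a = ω' (t - m t) a := fun t a ha => by
    rw [hωt t, Pi.add_apply, Pi.single_eq_of_ne ha, add_zero]
  -- (2) the steps
  have hstepV : ∀ k, (k = p ∨ k = q ∨ k = r) → ω (k + 1) - ω k = Pi.single 0 (g (k + 1) - g k) := by
    intro k hk
    obtain ⟨hmk, -⟩ := hstep_shift k
    rw [if_pos hk] at hmk
    funext a
    by_cases ha : a = 0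
    · subst ha
      rw [Pi.sub_apply, Pi.single_eq_same, hheight (k + 1) (by omega), hheight k (by rcases hk with h | h | h <;> omega)]
      ring
    · rw [Pi.sub_apply, Pi.single_eq_of_ne ha, hlat _ a ha, hlat _ a ha, hmk,
        show k + 1 - (m k + 1) = k - m k by omega, sub_self]
  have hstepL : ∀ k, ¬ (k = p ∨ k = q ∨ k = r) → ω (k + 1) - ω k = ω' (k - m k + 1) - ω' (k - m k) ∧ m (k + 1) = m k := by
    intro k hk
    obtain ⟨hmk, hgk⟩ := hstep_shift k
    rw [if_neg hk, add_zero] at hmk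
    have hg' : g (k + 1) = g k := by
      rw [hgk]; simp only [show ¬ k = p from fun h => hk (Or.inl h), show ¬ k = q from fun h => hk (Or.inr (Or.inl h)),
        show ¬ k = r from fun h => hk (Or.inr (Or.inr h)), if_false]; ring
    refine ⟨?_, hmk⟩
    have hk1 : k + 1 - m (k + 1) = k - m k + 1 := by
      rw [hmk]
      have := hm3 k
      -- `m k ≤ k`: the three indices counted are `< k`
      have hmk_le : m k ≤ k := by
        show (if p < k then 1 else 0) + (if q < k then 1 else 0) + (if r < k then 1 else 0) ≤ k
        split_ifs <;> omega
      omega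
    rw [hωt (k + 1), hωt k, hg', hk1]
    abel
  -- (3) membership in `saws`
  have hadj : ∀ k < u + 4, (zdGraph (u + 1)).Adj (ω k) (ω (k + 1)) := by
    intro k hk
    rw [zdGraph_adj_iff_sub]
    by_cases hV : k = p ∨ k = q ∨ k = r
    · refine ⟨0, ?_⟩
      have hs := hstepV k hV
      obtain ⟨-, hgk⟩ := hstep_shift k
      rcases hV with rfl | rfl | rfl
      · left; rw [hs, hgk]; simp; split_ifs <;> first | rfl | omega
      · right; rw [← neg_sub, hs, hgk, ← Pi.single_neg]; congr 1; split_ifs <;> omega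
      · left; rw [hs, hgk]; congr 1; split_ifs <;> omega
    · obtain ⟨hs, hmk⟩ := hstepL k hV
      have hlt : k - m k < u + 1 := by
        have := hρle (k + 1) (by omega)
        rw [hmk] at this; omega
      obtain ⟨j, hj⟩ := (zdGraph_adj_iff_sub _ _).1 (hadj' (k - m k) hlt)
      refine ⟨j, ?_⟩
      rcases hj with hj | hj
      · left; rw [hs, hj]
      · right; rw [← neg_sub, hs, ← neg_sub, hj, neg_neg]
  have hfrozen : ∀ t, u + 4 ≤ t → ω t = ω (u + 4) := by
    intro t ht
    obtain ⟨hm1, hg1⟩ := hend3 t ht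
    obtain ⟨hm2, hg2⟩ := hend3 (u + 4) le_rfl
    rw [hωt t, hωt (u + 4), hm1, hm2, hg1, hg2, hend' (t - 3) (by omega), hend' (u + 4 - 3) (by omega)]
  have hzero : ω 0 = 0 := by
    rw [hωt 0]
    have : m 0 = 0 ∧ g 0 = 0 := by
      constructor
      · show (if p < 0 then 1 else 0) + (if q < 0 then 1 else 0) + (if r < 0 then 1 else 0) = 0; simp
      · show ((if p < 0 then 1 else 0) - (if q < 0 then 1 else 0) + (if r < 0 then 1 else 0) : ℤ) = 0; simp
    rw [this.1, this.2, Nat.sub_zero, h0', Pi.single_zero, add_zero]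
  -- the shift is monotone, skips nothing twice in a row, and stalls exactly at p, q, r
  have hρmono : ∀ s t, s ≤ t → s - m s ≤ t - m t := by
    intro s t hst
    show s - ((if p < s then 1 else 0) + (if q < s then 1 else 0) + (if r < s then 1 else 0)) ≤
      t - ((if p < t then 1 else 0) + (if q < t then 1 else 0) + (if r < t then 1 else 0))
    split_ifs <;> omega
  have hρtwo : ∀ s t, s + 2 ≤ t → s - m s < t - m t := by
    intro s t hst
    show s - ((if p < s then 1 else 0) + (if q < s then 1 else 0) + (if r < s then 1 else 0)) <
      t - ((if p < t then 1 else 0) + (if q < t then 1 else 0) + (if r < t then 1 else 0))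
    split_ifs <;> omega
  have hinj : Set.InjOn ω {i | i ≤ u + 4} := by
    intro s hs t ht hst
    simp only [Set.mem_setOf_eq] at hs ht
    by_contra hne
    -- reduce to s < t
    have key : ∀ a b : ℕ, a ≤ u + 4 → b ≤ u + 4 → ω a = ω b → a < b → False := by
      intro a b ha hb hab hlt
      by_cases ha0 : a = 0
      · subst ha0
        have h1 := congrFun hab 0
        rw [hzero, hheight b (by omega)] at h1
        have := (hg01 b).1
        simp at h1; omega
      · -- same lateral part ⇒ same shifted time (ω' is injective on [0, u+1])
        have hl : ω' (a - m a) = ω' (b - m b) := by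
          have h1 := hab
          rw [hωt a, hωt b] at h1
          have hh : g a = g b := by
            have := congrFun hab 0
            rw [hheight a (by omega), hheight b (by omega)] at this; omega
          rw [hh] at h1
          exact add_right_cancel h1
        have hρeq : a - m a = b - m b :=
          hinj' (show a - m a ∈ {i | i ≤ u + 1} from hρle a ha) (show b - m b ∈ {i | i ≤ u + 1} from hρle b hb) hl
        -- hence b = a + 1 and a ∈ {p, q, r}, where the height jumps — contradiction with equal heights
        have hb1 : b = a + 1 := by
          by_contra hb1
          exact absurd hρeq (ne_of_lt (hρtwo a b (by omega)))
        subst hb1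
        have hh : g a = g (a + 1) := by
          have := congrFun hab 0
          rw [hheight a (by omega), hheight (a + 1) (by omega)] at this; omega
        obtain ⟨hmk, hgk⟩ := hstep_shift a
        have hV : a = p ∨ a = q ∨ a = r := by
          by_contra hV
          rw [if_neg hV, add_zero] at hmk
          have := hρ1 a (by omega)
          omega
        rw [hgk] at hh
        rcases hV with rfl | rfl | rfl
        · split_ifs at hh <;> omega
        · split_ifs at hh <;> omega
        · split_ifs at hh <;> omega
    rcases lt_or_gt_of_ne hne with hlt | hlt
    · exact key s t hs ht hst hlt
    · exact key t s ht hs hst.symm hlt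
  have hsawω : ω ∈ saws (u + 1) (u + 4) := mem_saws.2 ⟨hzero, hfrozen, hadj, hinj⟩
  -- (4) bridge, irreducible, cost, axes
  have hn2 : ω (u + 4) 0 = 2 := by rw [hheight (u + 4) (by omega), (hend3 (u + 4) le_rfl).2]; norm_num
  have hB : IsBridge (u + 4) ω := by
    intro i hi1 _
    rw [hheight i hi1, hn2, hzero, Pi.zero_apply]
    have := hg01 i
    constructor <;> omega
  have hirr : IsIrreducibleBridge (u + 4) ω := by
    refine ⟨by omega, hB, fun k hk1 hk2 hren => ?_⟩
    obtain ⟨-, hpre, hsuf⟩ := hren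
    -- heights at the three witnesses
    have hk := hheight k hk1
    have hgk := hg01 k
    by_cases hgk1 : g k = 1
    · -- height 2 at k: the suffix cannot climb above 2
      have h := (hsuf (u + 4 - k) (by omega) le_rfl).1
      simp only [add_zero, show k + (u + 4 - k) = u + 4 by omega] at h
      rw [hk, hn2, hgk1] at h
      norm_num at h
    · have hgk0 : g k = 0 := by omega
      -- height 1 at k: either k ≤ p (then time q+1 > k has height 1, not above) or q < k ≤ r (then time p+1 ≤ k has height 2 > 1)
      have hgdef : g k = (if p < k then 1 else 0) - (if q < k then 1 else 0) + (if r < k then 1 else 0) := rfl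
      by_cases hkp : k ≤ p
      · have h := (hsuf (q + 1 - k) (by omega) (by omega)).1
        simp only [add_zero, show k + (q + 1 - k) = q + 1 by omega] at h
        rw [hk, hgk0, hheight (q + 1) (by omega)] at h
        have : g (q + 1) = 0 := by
          show ((if p < q + 1 then 1 else 0) - (if q < q + 1 then 1 else 0) + (if r < q + 1 then 1 else 0) : ℤ) = 0
          split_ifs <;> omega
        rw [this] at h; norm_num at h
      · -- then q < k ≤ r (g k = 0 with p < k forces q < k and ¬ r < k)
        have hqk : q < k ∧ ¬ r < k := by
          rw [hgdef] at hgk0; split_ifs at hgk0 <;> omega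
        have h := (hpre (p + 1) (by omega) (by omega)).2
        rw [hheight (p + 1) (by omega), hk, hgk0] at h
        have : g (p + 1) = 1 := by
          show ((if p < p + 1 then 1 else 0) - (if q < p + 1 then 1 else 0) + (if r < p + 1 then 1 else 0) : ℤ) = 1
          split_ifs <;> omega
        rw [this] at h; norm_num at h
  refine Finset.mem_filter.2 ⟨mem_irreducibleBridges.2 ⟨mem_bridges.2 ⟨hsawω, hB⟩, hirr⟩, ?_, ?_⟩
  · rw [costZd, hn2]; simp
  · intro a ha
    obtain ⟨i, hi, hne⟩ := hall a ha
    -- an explicit preimage of `i` under the shift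
    set t : ℕ := i + ((if p ≤ i then 1 else 0) + (if q ≤ i + 1 then 1 else 0) + (if r ≤ i + 2 then 1 else 0)) with ht
    have hti : t - m t = i := by
      show t - ((if p < t then 1 else 0) + (if q < t then 1 else 0) + (if r < t then 1 else 0)) = i
      rw [ht]
      split_ifs <;> omega
    refine ⟨t, by rw [ht]; split_ifs <;> omega, ?_⟩
    rw [hlat t a ha, hti]
    exact hne

/-- The insertion indices are determined by the height profile: if two admissible triples give the same extra-height function `g` on
`t ≥ 1`, the second triple is componentwise `≤` the first. [cite: MadrasSlade1993, §4.2; lane plumbing] -/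
private theorem st_triple_le {p q r p' q' r' : ℕ}
    (hp : 1 ≤ p) (hpq : p + 2 ≤ q) (hqr : q + 2 ≤ r) (hqr' : q' + 2 ≤ r')
    (hg : ∀ t : ℕ, 1 ≤ t → ((if p < t then 1 else 0) - (if q < t then 1 else 0) + (if r < t then 1 else 0) : ℤ) =
      ((if p' < t then 1 else 0) - (if q' < t then 1 else 0) + (if r' < t then 1 else 0) : ℤ)) :
    p' ≤ p ∧ (p = p' → q' ≤ q) ∧ (p = p' → q = q' → r' ≤ r) := by
  refine ⟨?_, fun hpp => ?_, fun hpp hqq => ?_⟩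
  · by_contra hlt
    have h := hg (p + 1) (by omega)
    split_ifs at h <;> omega
  · by_contra hlt
    have h := hg (q + 1) (by omega)
    split_ifs at h <;> omega
  · by_contra hlt
    have h := hg (r + 1) (by omega)
    split_ifs at h <;> omega

/-- ★ INJECTIVITY OF THE INSERTION: the inserted walk determines the insertion indices (by its height profile) and the span-one bridge
`ω'` (by its lateral parts). [cite: MadrasSlade1993, §4.2; lane lemma] -/
theorem insert_injective_spanTwoTopClass {ω ω'₁ ω'₂ : ℕ → Site (u + 1)} {p₁ q₁ r₁ p₂ q₂ r₂ : ℕ}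
    (h₁ : ω'₁ ∈ (irreducibleBridges (u + 1) (u + 1)).filter fun (ω : ℕ → Site (u + 1)) => costZd u (u + 1) ω = u ∧
        ∀ a : Fin (u + 1), a ≠ 0 → ∃ i ≤ u + 1, ω i a ≠ (0 : ℤ))
    (h₂ : ω'₂ ∈ (irreducibleBridges (u + 1) (u + 1)).filter fun (ω : ℕ → Site (u + 1)) => costZd u (u + 1) ω = u ∧
        ∀ a : Fin (u + 1), a ≠ 0 → ∃ i ≤ u + 1, ω i a ≠ (0 : ℤ))
    (hp₁ : 1 ≤ p₁) (hpq₁ : p₁ + 2 ≤ q₁) (hqr₁ : q₁ + 2 ≤ r₁) (hr₁ : r₁ ≤ u + 3)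
    (hp₂ : 1 ≤ p₂) (hpq₂ : p₂ + 2 ≤ q₂) (hqr₂ : q₂ + 2 ≤ r₂) (hr₂ : r₂ ≤ u + 3)
    (hω₁ : ∀ t : ℕ, ω t = ω'₁ (t - ((if p₁ < t then 1 else 0) + (if q₁ < t then 1 else 0) + (if r₁ < t then 1 else 0))) +
      Pi.single (0 : Fin (u + 1)) (((if p₁ < t then 1 else 0) - (if q₁ < t then 1 else 0) + (if r₁ < t then 1 else 0) : ℤ)))
    (hω₂ : ∀ t : ℕ, ω t = ω'₂ (t - ((if p₂ < t then 1 else 0) + (if q₂ < t then 1 else 0) + (if r₂ < t then 1 else 0))) +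
      Pi.single (0 : Fin (u + 1)) (((if p₂ < t then 1 else 0) - (if q₂ < t then 1 else 0) + (if r₂ < t then 1 else 0) : ℤ))) :
    p₁ = p₂ ∧ q₁ = q₂ ∧ r₁ = r₂ ∧ ω'₁ = ω'₂ := by
  -- equal heights ⇒ equal extra-height functions on `t ≥ 1`
  have hg : ∀ t : ℕ, 1 ≤ t → ((if p₁ < t then 1 else 0) - (if q₁ < t then 1 else 0) + (if r₁ < t then 1 else 0) : ℤ) =
      ((if p₂ < t then 1 else 0) - (if q₂ < t then 1 else 0) + (if r₂ < t then 1 else 0) : ℤ) := by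
    intro t ht
    have e1 := st_insert_apply_zero h₁ hp₁ hpq₁ hqr₁ hr₁ hω₁ ht
    have e2 := st_insert_apply_zero h₂ hp₂ hpq₂ hqr₂ hr₂ hω₂ ht
    rw [e1] at e2
    omega
  obtain ⟨a1, a2, a3⟩ := st_triple_le hp₁ hpq₁ hqr₁ hqr₂ hg
  obtain ⟨b1, b2, b3⟩ := st_triple_le hp₂ hpq₂ hqr₂ hqr₁ (fun t ht => (hg t ht).symm)
  have hp : p₁ = p₂ := by omega
  have hq : q₁ = q₂ := by have := a2 hp; have := b2 hp.symm; omega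
  have hr : r₁ = r₂ := by have := a3 hp hq; have := b3 hp.symm hq.symm; omega
  subst hp; subst hq; subst hr
  refine ⟨rfl, rfl, rfl, ?_⟩
  -- equal shifted walks on an onto shift ⇒ equal span-one bridges
  obtain ⟨hI₁, -, -⟩ := Finset.mem_filter.1 h₁
  obtain ⟨hI₂, -, -⟩ := Finset.mem_filter.1 h₂
  obtain ⟨-, hend₁, -, -⟩ := mem_saws.1 ((mem_bridges.1 (mem_irreducibleBridges.1 hI₁).1).1 : ω'₁ ∈ saws (u + 1) (u + 1))
  obtain ⟨-, hend₂, -, -⟩ := mem_saws.1 ((mem_bridges.1 (mem_irreducibleBridges.1 hI₂).1).1 : ω'₂ ∈ saws (u + 1) (u + 1))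
  have hshift : ∀ t, ω'₁ (t - ((if p₁ < t then 1 else 0) + (if q₁ < t then 1 else 0) + (if r₁ < t then 1 else 0))) =
      ω'₂ (t - ((if p₁ < t then 1 else 0) + (if q₁ < t then 1 else 0) + (if r₁ < t then 1 else 0))) := by
    intro t
    have := hω₁ t
    rw [hω₂ t] at this
    exact (add_right_cancel this).symm
  have hle : ∀ s, s ≤ u + 1 → ω'₁ s = ω'₂ s := by
    intro s _
    -- explicit preimage of `s` under the shift
    have h := hshift (s + ((if p₁ ≤ s then 1 else 0) + (if q₁ ≤ s + 1 then 1 else 0) + (if r₁ ≤ s + 2 then 1 else 0)))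
    have hidx : s + ((if p₁ ≤ s then 1 else 0) + (if q₁ ≤ s + 1 then 1 else 0) + (if r₁ ≤ s + 2 then 1 else 0)) -
        ((if p₁ < s + ((if p₁ ≤ s then 1 else 0) + (if q₁ ≤ s + 1 then 1 else 0) + (if r₁ ≤ s + 2 then 1 else 0)) then 1 else 0) +
         (if q₁ < s + ((if p₁ ≤ s then 1 else 0) + (if q₁ ≤ s + 1 then 1 else 0) + (if r₁ ≤ s + 2 then 1 else 0)) then 1 else 0) +
         (if r₁ < s + ((if p₁ ≤ s then 1 else 0) + (if q₁ ≤ s + 1 then 1 else 0) + (if r₁ ≤ s + 2 then 1 else 0)) then 1 else 0)) = s := by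
      split_ifs <;> omega
    rw [hidx] at h
    exact h
  funext s
  by_cases hs : s ≤ u + 1
  · exact hle s hs
  · rw [hend₁ s (by omega), hend₂ s (by omega), hle (u + 1) le_rfl]

/-- ★★ LOWER BOUND FOR THE TOP AXIS CLASS OF THE SPAN-TWO CELL: `F_{c,c+2}(c−2) ≥ 2^{c−2}·(c−2)!·#{admissible triples}`, where with
`u = c − 2` the admissible triples are `1 ≤ p`, `p + 2 ≤ q`, `q + 2 ≤ r ≤ u + 3` (their number is `C(u+1, 3) = C(c−1, 3)`; the matching
upper bound — every member of the class is an insertion, by the rigidity above — is left to the sequel).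
[cite: MadrasSlade1993, §4.2, eq. (4.2.20)–(4.2.22); lane theorem] -/
theorem le_card_spanTwoTopClass (u : ℕ) :
    2 ^ u * u.factorial * (((Finset.range (u + 4)) ×ˢ ((Finset.range (u + 4)) ×ˢ (Finset.range (u + 4)))).filter
        fun (x : ℕ × ℕ × ℕ) => 1 ≤ x.1 ∧ x.1 + 2 ≤ x.2.1 ∧ x.2.1 + 2 ≤ x.2.2 ∧ x.2.2 ≤ u + 3).card ≤
      ((irreducibleBridges (u + 1) (u + 4)).filter fun (ω : ℕ → Site (u + 1)) => costZd u (u + 4) ω = u + 2 ∧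
        ∀ a : Fin (u + 1), a ≠ 0 → ∃ i ≤ u + 4, ω i a ≠ (0 : ℤ)).card := by
  classical
  set S := (irreducibleBridges (u + 1) (u + 1)).filter fun (ω : ℕ → Site (u + 1)) => costZd u (u + 1) ω = u ∧
    ∀ a : Fin (u + 1), a ≠ 0 → ∃ i ≤ u + 1, ω i a ≠ (0 : ℤ) with hS
  set TR := (((Finset.range (u + 4)) ×ˢ ((Finset.range (u + 4)) ×ˢ (Finset.range (u + 4)))).filter
    fun (x : ℕ × ℕ × ℕ) => 1 ≤ x.1 ∧ x.1 + 2 ≤ x.2.1 ∧ x.2.1 + 2 ≤ x.2.2 ∧ x.2.2 ≤ u + 3) with hTR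
  have hScard : S.card = 2 ^ u * u.factorial := card_topAxesClass_self u
  rw [← hScard, ← Finset.card_product]
  refine Finset.card_le_card_of_injOn (fun x => fun t : ℕ =>
      x.1 (t - ((if x.2.1 < t then 1 else 0) + (if x.2.2.1 < t then 1 else 0) + (if x.2.2.2 < t then 1 else 0))) +
        Pi.single (0 : Fin (u + 1)) (((if x.2.1 < t then 1 else 0) - (if x.2.2.1 < t then 1 else 0) +
          (if x.2.2.2 < t then 1 else 0) : ℤ))) ?_ ?_
  · intro x hx
    rw [Finset.mem_coe, Finset.mem_product] at hx
    obtain ⟨hω', htr⟩ := hx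
    rw [hTR, Finset.mem_filter] at htr
    obtain ⟨-, h1, h2, h3, h4⟩ := htr
    exact Finset.mem_coe.2 (insert_mem_spanTwoTopClass hω' h1 h2 h3 h4 (fun t => rfl))
  · intro x hx y hy hxy
    rw [Finset.mem_coe, Finset.mem_product] at hx hy
    obtain ⟨hω'x, htrx⟩ := hx
    obtain ⟨hω'y, htry⟩ := hy
    rw [hTR, Finset.mem_filter] at htrx htry
    obtain ⟨-, x1, x2, x3, x4⟩ := htrx
    obtain ⟨-, y1, y2, y3, y4⟩ := htry
    obtain ⟨e1, e2, e3, e4⟩ := insert_injective_spanTwoTopClass hω'x hω'y x1 x2 x3 x4 y1 y2 y3 y4 (fun t => rfl)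
      (fun t => by have := congrFun hxy t; exact this)
    exact Prod.ext e4 (Prod.ext e1 (Prod.ext e2 e3))

/-- Pairs `1 ≤ p`, `p + 2 ≤ q ≤ u + 2` number `C(u+1, 2)`. [cite: MadrasSlade1993, §4.2; lane plumbing] -/
private theorem st_card_pairs (u : ℕ) :
    (((Finset.range (u + 3)) ×ˢ (Finset.range (u + 3))).filter
      fun (x : ℕ × ℕ) => 1 ≤ x.1 ∧ x.1 + 2 ≤ x.2 ∧ x.2 ≤ u + 2).card = (u + 1).choose 2 := by
  induction u with
  | zero =>
    have : (((Finset.range (0 + 3)) ×ˢ (Finset.range (0 + 3))).filter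
        fun (x : ℕ × ℕ) => 1 ≤ x.1 ∧ x.1 + 2 ≤ x.2 ∧ x.2 ≤ 0 + 2) = ∅ :=
      Finset.filter_eq_empty_iff.2 fun x hx => by
        simp only [Finset.mem_product, Finset.mem_range] at hx; omega
    rw [this, Finset.card_empty]; decide
  | succ u ih =>
    have hsplit := Finset.card_filter_add_card_filter_not
      (s := ((Finset.range (u + 1 + 3)) ×ˢ (Finset.range (u + 1 + 3))).filter
        fun (x : ℕ × ℕ) => 1 ≤ x.1 ∧ x.1 + 2 ≤ x.2 ∧ x.2 ≤ u + 1 + 2) (fun (x : ℕ × ℕ) => x.2 ≤ u + 2)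
    have h1 : (((Finset.range (u + 1 + 3)) ×ˢ (Finset.range (u + 1 + 3))).filter
        (fun (x : ℕ × ℕ) => 1 ≤ x.1 ∧ x.1 + 2 ≤ x.2 ∧ x.2 ≤ u + 1 + 2)).filter (fun (x : ℕ × ℕ) => x.2 ≤ u + 2) =
        ((Finset.range (u + 3)) ×ˢ (Finset.range (u + 3))).filter
          fun (x : ℕ × ℕ) => 1 ≤ x.1 ∧ x.1 + 2 ≤ x.2 ∧ x.2 ≤ u + 2 := by
      ext x
      simp only [Finset.mem_filter, Finset.mem_product, Finset.mem_range]
      omega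
    have h2 : ((((Finset.range (u + 1 + 3)) ×ˢ (Finset.range (u + 1 + 3))).filter
        (fun (x : ℕ × ℕ) => 1 ≤ x.1 ∧ x.1 + 2 ≤ x.2 ∧ x.2 ≤ u + 1 + 2)).filter (fun (x : ℕ × ℕ) => ¬ x.2 ≤ u + 2)).card =
        u + 1 := by
      have : (((Finset.range (u + 1 + 3)) ×ˢ (Finset.range (u + 1 + 3))).filter
          (fun (x : ℕ × ℕ) => 1 ≤ x.1 ∧ x.1 + 2 ≤ x.2 ∧ x.2 ≤ u + 1 + 2)).filter (fun (x : ℕ × ℕ) => ¬ x.2 ≤ u + 2) =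
          (Finset.Icc 1 (u + 1)).image fun p => (p, u + 3) := by
        ext x
        simp only [Finset.mem_filter, Finset.mem_product, Finset.mem_range, Finset.mem_image, Finset.mem_Icc, Prod.ext_iff]
        constructor
        · rintro ⟨⟨⟨-, -⟩, h1, h2, h3⟩, h4⟩
          exact ⟨x.1, ⟨h1, by omega⟩, rfl, by omega⟩
        · rintro ⟨p, ⟨hp1, hp2⟩, hp, hq⟩
          omega
      rw [this, Finset.card_image_of_injective _ (fun a b h => (Prod.ext_iff.1 h).1), Nat.card_Icc]
      omega
    rw [h1, h2, ih] at hsplit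
    rw [← hsplit, Nat.choose_succ_succ (u + 1) 1, Nat.choose_one_right]
    ring

/-- ★ The admissible triples `1 ≤ p`, `p + 2 ≤ q`, `q + 2 ≤ r ≤ u + 3` number `C(u+1, 3)`. [cite: MadrasSlade1993, §4.2; lane lemma] -/
theorem card_admissibleTriples (u : ℕ) :
    (((Finset.range (u + 4)) ×ˢ ((Finset.range (u + 4)) ×ˢ (Finset.range (u + 4)))).filter
      fun (x : ℕ × ℕ × ℕ) => 1 ≤ x.1 ∧ x.1 + 2 ≤ x.2.1 ∧ x.2.1 + 2 ≤ x.2.2 ∧ x.2.2 ≤ u + 3).card = (u + 1).choose 3 := by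
  induction u with
  | zero =>
    have : (((Finset.range (0 + 4)) ×ˢ ((Finset.range (0 + 4)) ×ˢ (Finset.range (0 + 4)))).filter
        fun (x : ℕ × ℕ × ℕ) => 1 ≤ x.1 ∧ x.1 + 2 ≤ x.2.1 ∧ x.2.1 + 2 ≤ x.2.2 ∧ x.2.2 ≤ 0 + 3) = ∅ :=
      Finset.filter_eq_empty_iff.2 fun x hx => by
        simp only [Finset.mem_product, Finset.mem_range] at hx; omega
    rw [this, Finset.card_empty]; decide
  | succ u ih =>
    have hsplit := Finset.card_filter_add_card_filter_not
      (s := ((Finset.range (u + 1 + 4)) ×ˢ ((Finset.range (u + 1 + 4)) ×ˢ (Finset.range (u + 1 + 4)))).filter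
        fun (x : ℕ × ℕ × ℕ) => 1 ≤ x.1 ∧ x.1 + 2 ≤ x.2.1 ∧ x.2.1 + 2 ≤ x.2.2 ∧ x.2.2 ≤ u + 1 + 3)
      (fun (x : ℕ × ℕ × ℕ) => x.2.2 ≤ u + 3)
    have h1 : ((((Finset.range (u + 1 + 4)) ×ˢ ((Finset.range (u + 1 + 4)) ×ˢ (Finset.range (u + 1 + 4)))).filter
        fun (x : ℕ × ℕ × ℕ) => 1 ≤ x.1 ∧ x.1 + 2 ≤ x.2.1 ∧ x.2.1 + 2 ≤ x.2.2 ∧ x.2.2 ≤ u + 1 + 3).filter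
          (fun (x : ℕ × ℕ × ℕ) => x.2.2 ≤ u + 3)) =
        ((Finset.range (u + 4)) ×ˢ ((Finset.range (u + 4)) ×ˢ (Finset.range (u + 4)))).filter
          fun (x : ℕ × ℕ × ℕ) => 1 ≤ x.1 ∧ x.1 + 2 ≤ x.2.1 ∧ x.2.1 + 2 ≤ x.2.2 ∧ x.2.2 ≤ u + 3 := by
      ext x
      simp only [Finset.mem_filter, Finset.mem_product, Finset.mem_range]
      omega
    have h2 : ((((Finset.range (u + 1 + 4)) ×ˢ ((Finset.range (u + 1 + 4)) ×ˢ (Finset.range (u + 1 + 4)))).filter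
        fun (x : ℕ × ℕ × ℕ) => 1 ≤ x.1 ∧ x.1 + 2 ≤ x.2.1 ∧ x.2.1 + 2 ≤ x.2.2 ∧ x.2.2 ≤ u + 1 + 3).filter
          (fun (x : ℕ × ℕ × ℕ) => ¬ x.2.2 ≤ u + 3)).card = (u + 1).choose 2 := by
      have : ((((Finset.range (u + 1 + 4)) ×ˢ ((Finset.range (u + 1 + 4)) ×ˢ (Finset.range (u + 1 + 4)))).filter
          fun (x : ℕ × ℕ × ℕ) => 1 ≤ x.1 ∧ x.1 + 2 ≤ x.2.1 ∧ x.2.1 + 2 ≤ x.2.2 ∧ x.2.2 ≤ u + 1 + 3).filter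
            (fun (x : ℕ × ℕ × ℕ) => ¬ x.2.2 ≤ u + 3)) =
          ((((Finset.range (u + 3)) ×ˢ (Finset.range (u + 3))).filter
            fun (x : ℕ × ℕ) => 1 ≤ x.1 ∧ x.1 + 2 ≤ x.2 ∧ x.2 ≤ u + 2).image fun x => (x.1, x.2, u + 4)) := by
        ext x
        simp only [Finset.mem_filter, Finset.mem_product, Finset.mem_range, Finset.mem_image, Prod.ext_iff]
        constructor
        · rintro ⟨⟨⟨-, -, -⟩, h1, h2, h3, h4⟩, h5⟩
          exact ⟨(x.1, x.2.1), ⟨⟨by omega, by omega⟩, h1, h2, by omega⟩, rfl, rfl, by omega⟩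
        · rintro ⟨y, ⟨⟨-, -⟩, h1, h2, h3⟩, hy1, hy2, hy3⟩
          omega
      rw [this, Finset.card_image_of_injective, st_card_pairs u]
      intro a b h
      simp only [Prod.ext_iff] at h
      exact Prod.ext h.1 h.2.1
    rw [h1, h2, ih] at hsplit
    rw [← hsplit, Nat.choose_succ_succ (u + 1) 2]
    ring

/-- ★★ Hence `F_{c,c+2}(c−2) ≥ C(c−1,3)·(c−2)!·2^{c−2}` (with `u = c − 2`). [cite: MadrasSlade1993, §4.2, eq. (4.2.20)–(4.2.22); lane theorem] -/
theorem choose_mul_le_card_spanTwoTopClass (u : ℕ) :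
    2 ^ u * u.factorial * (u + 1).choose 3 ≤
      ((irreducibleBridges (u + 1) (u + 4)).filter fun (ω : ℕ → Site (u + 1)) => costZd u (u + 4) ω = u + 2 ∧
        ∀ a : Fin (u + 1), a ≠ 0 → ∃ i ≤ u + 4, ω i a ≠ (0 : ℤ)).card := by
  rw [← card_admissibleTriples u]
  exact le_card_spanTwoTopClass u

end Insert
end Literature.Probability.RandomPlanarGeometry.SAW.Zd
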